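import Literature.AlgebraicGeometry.ShimuraVarieties.UnitaryAuxiliaryTorusDatumExt
import Literature.AlgebraicGeometry.Motives.FiniteCoproductVarieties
import HarnessLib

/-!
# Complex points of the twisted auxiliary Shimura variety `Sh_{K×L₀}(G × T₀(M), X × {h_Φ})_ℂ = ∐_p Sh_K(U(H), 𝔹²)_ℂ`:
# every point is a summand point `([x, aK], p)`, and the Hecke translations / transition maps act on them as printed

Topic `AlgebraicGeometry/ShimuraVarieties`; namespace
`Literature.AlgebraicGeometry.ShimuraVarieties.UnitaryCanonicalModel.Aux` (vocabulary of `UnitaryAuxiliaryTorusDatumExt`: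
`complexSystemExt M Sc L₀`, `summandPointExt M Sc L₀ K p x a = ([x, aK], p)`, `translMorExt M Sc L₀ K c`).  THEOREMS ONLY: no definition,
no named fact, no instance, no `sorry`.  Cell hodgecm-mathlib (D-0151), hDel line, leaf I-1′; these are the point-level bookkeeping
identities («(P2)/(P3)/(P6)–(P9)» of the cell bus, 2026-08-28T10:23:45Z / B-plan2 S3 ASKS v1 10:49:13Z leaf (T2)) that the S3 layer (`stub_closureDescent`, [Deligne1971TravauxShimura]
Cor. 5.7 / Variante 5.9: the transition maps and the class-group translations commute with `Aut(ℂ/E)` on the special points, hence descend)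
of the planning workfile `Cruxes/HDel/Lines/F1ExtHodgeType.lean` reads.  HC_CM is proved only modulo the 7 printed citations until rung 0
closes; this file is banked generic plumbing toward I-1′ and changes no floor count.

## The mathematics (printed)

[Milne2005ShimuraVarieties] Lemma 5.13 p. 57 and p. 62 L34–40: `Sh_K(G,X)(ℂ) = G(ℚ)\X × G(𝔸_f)/K`, and for the product with a
zero-dimensional datum the complex points are the disjoint union over the finite class set; (33) p. 58: the Hecke operator `T(g)` acts
by `[x, a] ↦ [x, ag]` and the transition maps by `[x, aK] ↦ [x, aK']`.  For the tree's `complexSystemExt M Sc L₀` (a finite coproduct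
`∐_{p ∈ classGroup M L₀} Sc.Mc_K` of copies of the complex model), the complex points of the coproduct are the topological disjoint union
of the complex points of the summands (tree `Motives.exists_sigmaHomeomorph_of_isColimit_cofan`, SGA1 XII Prop. 3.1 (xi)), the summand
inclusions are the coproduct injections `Sigma.ι`, the torus translation by `c` is `Sigma.desc (p ↦ Sigma.ι (c·p))` and the transition
map is `Sigma.map (Sc.Mc.map f)`; the identities below are these three facts read on points, plus `Sc.map_pts`.

## Main statements

* `exists_summandPointExt_eq` — every complex point of `(complexSystemExt M Sc L₀).obj K` is `([x, aK], p)` for some `p, x, a`.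
* `summandPointExt_eq_summandPointExt_iff` — `([x, aK], p) = ([x', a'K], p') ↔ p = p' ∧ [x, aK] = [x', a'K]`.
* `map_translMorExt_summandPointExt` — `c · ([x, aK], p) = ([x, aK], c·p)`.
* `map_complexSystemExt_map_summandPointExt` — the transition map `K → K'` sends `([x, aK], p) ↦ ([x, aK'], p)`.
* `pt_summandPointExt_mem_range` — the underlying point of `([x, aK], p)` lies in the `p`-th summand.
* `translMorExt_comp_map`, `translMorExt_one`, `translMorExt_mul` (+ `_inv_comp` / `_comp_inv`) — the translations form an action
  of `classGroup M L₀` by automorphisms commuting with the transition maps (as MORPHISMS, by `Sigma.hom_ext`).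

## References
* [Milne2005ShimuraVarieties] J. S. Milne, *Introduction to Shimura varieties* (2005), Lemma 5.13 p. 57, (33) p. 58, p. 62 L34–40.
* [Deligne1979ShimuraVarieties] P. Deligne, *Variétés de Shimura* (1979), 2.1.2 and 2.1.4 (PDF p. 24 of Milne's translation).
* [Liu2021] Y. Liu, *Fourier–Jacobi cycles and arithmetic relative trace formula*, Camb. J. Math. 9 (2021), App. C (C.6) p. 114.
* [SGA1] A. Grothendieck, M. Raynaud, *SGA 1*, Exp. XII Prop. 3.1 (xi).
-/

set_option autoImplicit false

noncomputable section

open Function MulAction Topology NumberField IsDedekindDomain CategoryTheory CategoryTheory.Limits Matrix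
  AlgebraicGeometry
open scoped Matrix ComplexOrder
open Literature.AlgebraicGeometry.Motives
open Literature.NumberTheory.Automorphic Literature.NumberTheory.Automorphic.UnitaryGroup
open Literature.NumberTheory.Automorphic.ShimuraDissection
open Literature.NumberTheory.Automorphic.Liu2021.AppendixC (C5.OpenCompactSubgroup C5.SmallLevel)
open Literature.Geometry.ComplexHyperbolic Literature.Geometry.ComplexHyperbolic.BallModel

namespace Literature.AlgebraicGeometry.ShimuraVarieties

namespace UnitaryCanonicalModel

namespace Aux

variable {L : Type} [Field L] [NumberField L] [IsCMField L]
variable {H : Matrix (Fin 3) (Fin 3) L} {τ : L →+* ℂ} {T : GL (Fin 3) ℂ}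
  {hT : formCongr (starRingEnd ℂ) T (H.map τ) = BallModel.J}
  {K₀ : C5.OpenCompactSubgroup ↥(finAdelic (↥(maximalRealSubfield L)) L (IsCMField.complexConj L) 3 H)}
variable (M : Type) [Field M] [NumberField M] [IsCMField M]

/-! ### §0. The coproduct structure, definitionally (bookkeeping `rfl` lemmas) -/

/-- `Sh_{K×L₀}(G̃_M, X̃_M)_ℂ` IS the coproduct `∐_p Sc.Mc_K` (definitional unfolding of `complexSystemExt`).
[cite: Deligne1979ShimuraVarieties, 2.1.2 (PDF p. 24 of Milne's translation)] -/
theorem complexSystemExt_obj (Sc : ComplexRecordSystem L H τ T hT K₀) (L₀ : C5.OpenCompactSubgroup ↥(torusFinAdelic M))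
    (K : C5.SmallLevel K₀) :
    (complexSystemExt M Sc L₀).obj K = ∐ fun _ : classGroup M L₀ => Sc.Mc.obj K := rfl

/-- The transition map of `Sh_{K×L₀}(G̃_M, X̃_M)_ℂ` is `Sigma.map` of the transition maps of the summands (definitional).
[cite: Deligne1979ShimuraVarieties, 2.1.4 (PDF p. 24 of Milne's translation)] -/
theorem complexSystemExt_map (Sc : ComplexRecordSystem L H τ T hT K₀) (L₀ : C5.OpenCompactSubgroup ↥(torusFinAdelic M))
    {K K' : C5.SmallLevel K₀} (f : K ⟶ K') :
    (complexSystemExt M Sc L₀).map f = Limits.Sigma.map fun _ : classGroup M L₀ => Sc.Mc.map f := rfl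

/-- The `p`-th summand inclusion followed by the transition map is the summand's transition map followed by the `p`-th inclusion
(`Sigma.ι_map`). [cite: Deligne1979ShimuraVarieties, 2.1.4 (PDF p. 24 of Milne's translation)] -/
theorem ι_comp_complexSystemExt_map (Sc : ComplexRecordSystem L H τ T hT K₀) (L₀ : C5.OpenCompactSubgroup ↥(torusFinAdelic M))
    {K K' : C5.SmallLevel K₀} (f : K ⟶ K') (p : classGroup M L₀) :
    Limits.Sigma.ι (fun _ : classGroup M L₀ => Sc.Mc.obj K) p ≫ (complexSystemExt M Sc L₀).map f =
      Sc.Mc.map f ≫ Limits.Sigma.ι (fun _ : classGroup M L₀ => Sc.Mc.obj K') p := by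
  rw [complexSystemExt_map]
  exact Limits.Sigma.ι_map _ _

/-- The `p`-th summand inclusion followed by the translation by `c` is the `(c·p)`-th inclusion (`Sigma.ι_desc`; definitional unfolding
of `translMorExt`). [cite: Milne2005ShimuraVarieties, (33) p. 58] -/
theorem ι_comp_translMorExt (Sc : ComplexRecordSystem L H τ T hT K₀) (L₀ : C5.OpenCompactSubgroup ↥(torusFinAdelic M))
    (K : C5.SmallLevel K₀) (c p : classGroup M L₀) :
    Limits.Sigma.ι (fun _ : classGroup M L₀ => Sc.Mc.obj K) p ≫ translMorExt M Sc L₀ K c =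
      Limits.Sigma.ι (fun _ : classGroup M L₀ => Sc.Mc.obj K) (c * p) :=
  Limits.Sigma.ι_desc _ _

/-! ### §1. Every complex point is a summand point `([x, aK], p)`; equality of summand points -/

/-- **Every complex point of `Sh_{K×L₀}(G̃_M, X̃_M)_ℂ = ∐_p Sc.Mc_K` is a summand point `([x, aK], p)`**: the complex points of the
finite coproduct are the disjoint union of the complex points of the summands (`Motives.exists_sigmaHomeomorph_of_isColimit_cofan`),
`Sc.pts K : Sc.Mc_K(ℂ) ≃ₜ Sh_K(ℂ)`, and every point of `Sh_K(ℂ)` is a class `[x, aK]` (`ShimuraSet.mk_surjective`).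
[cite: Milne2005ShimuraVarieties, Lemma 5.13 p. 57; p. 62 L34–40] [cite: Deligne1979ShimuraVarieties, 2.1.2 (PDF p. 24 of Milne's translation)] -/
theorem exists_summandPointExt_eq (Sc : ComplexRecordSystem L H τ T hT K₀) (L₀ : C5.OpenCompactSubgroup ↥(torusFinAdelic M))
    (K : C5.SmallLevel K₀) (P : ComplexPoints ((complexSystemExt M Sc L₀).obj K)) :
    ∃ (p : classGroup M L₀) (x : Ball) (a : finAdelic (↥(maximalRealSubfield L)) L (IsCMField.complexConj L) 3 H),
      summandPointExt M Sc L₀ K p x a = P := by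
  obtain ⟨Φ, hΦ⟩ := Motives.exists_sigmaHomeomorph_of_isColimit_cofan (k := ℂ) ℂ
    (coproductIsCoproduct fun _ : classGroup M L₀ => Sc.Mc.obj K)
  obtain ⟨⟨p, Q⟩, hQ⟩ := Φ.surjective P
  obtain ⟨⟨x, a⟩, hxa⟩ := ShimuraSet.mk_surjective L H τ T hT K.1.1 (Sc.pts K Q)
  refine ⟨p, x, a, ?_⟩
  have hQ' : (Sc.pts K).symm (ShimuraSet.mk L H τ T hT K.1.1 x a) = Q := by
    rw [(Sc.pts K).symm_apply_eq]
    exact hxa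
  rw [← hQ, hΦ, ← hQ']
  rfl

/-- **Equality of summand points**: `([x, aK], p) = ([x', a'K], p')` in `Sh_{K×L₀}(G̃_M, X̃_M)(ℂ)` iff `p = p'` and `[x, aK] = [x', a'K]`
in `Sh_K(ℂ)` (the summand inclusions are jointly injective with disjoint images; `Sc.pts K` is a bijection).
[cite: Milne2005ShimuraVarieties, Lemma 5.13 p. 57; p. 62 L34–40] -/
theorem summandPointExt_eq_summandPointExt_iff (Sc : ComplexRecordSystem L H τ T hT K₀)
    (L₀ : C5.OpenCompactSubgroup ↥(torusFinAdelic M)) (K : C5.SmallLevel K₀) (p p' : classGroup M L₀) (x x' : Ball)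
    (a a' : finAdelic (↥(maximalRealSubfield L)) L (IsCMField.complexConj L) 3 H) :
    summandPointExt M Sc L₀ K p x a = summandPointExt M Sc L₀ K p' x' a' ↔
      p = p' ∧ ShimuraSet.mk L H τ T hT K.1.1 x a = ShimuraSet.mk L H τ T hT K.1.1 x' a' := by
  constructor
  · intro h
    obtain ⟨Φ, hΦ⟩ := Motives.exists_sigmaHomeomorph_of_isColimit_cofan (k := ℂ) ℂ
      (coproductIsCoproduct fun _ : classGroup M L₀ => Sc.Mc.obj K)
    have h' : Φ ⟨p, (Sc.pts K).symm (ShimuraSet.mk L H τ T hT K.1.1 x a)⟩ =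
        Φ ⟨p', (Sc.pts K).symm (ShimuraSet.mk L H τ T hT K.1.1 x' a')⟩ := by
      rw [hΦ, hΦ]
      exact h
    have h'' := Φ.injective h'
    obtain ⟨rfl, hQ⟩ := Sigma.mk.inj_iff.1 h''
    exact ⟨rfl, (Sc.pts K).symm.injective (eq_of_heq hQ)⟩
  · rintro ⟨rfl, h⟩
    rw [summandPointExt, summandPointExt, h]

/-- The summand point `([x, aK], p)` only depends on the class `[x, aK] ∈ Sh_K(ℂ)` (a restatement of the definition through `Sc.pts`).
[cite: Milne2005ShimuraVarieties, Lemma 5.13 p. 57] -/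
theorem summandPointExt_eq_of_mk_eq (Sc : ComplexRecordSystem L H τ T hT K₀)
    (L₀ : C5.OpenCompactSubgroup ↥(torusFinAdelic M)) (K : C5.SmallLevel K₀) (p : classGroup M L₀) {x x' : Ball}
    {a a' : finAdelic (↥(maximalRealSubfield L)) L (IsCMField.complexConj L) 3 H}
    (h : ShimuraSet.mk L H τ T hT K.1.1 x a = ShimuraSet.mk L H τ T hT K.1.1 x' a') :
    summandPointExt M Sc L₀ K p x a = summandPointExt M Sc L₀ K p x' a' := by
  rw [summandPointExt, summandPointExt, h]

/-- **The underlying point of `([x, aK], p)` lies in the `p`-th summand** (the image of the coproduct injection `Sigma.ι _ p`).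
[cite: Milne2005ShimuraVarieties, p. 62 L34–40] -/
theorem pt_summandPointExt_mem_range (Sc : ComplexRecordSystem L H τ T hT K₀)
    (L₀ : C5.OpenCompactSubgroup ↥(torusFinAdelic M)) (K : C5.SmallLevel K₀) (p : classGroup M L₀) (x : Ball)
    (a : finAdelic (↥(maximalRealSubfield L)) L (IsCMField.complexConj L) 3 H) :
    (summandPointExt M Sc L₀ K p x a).pt ∈
      Set.range (Limits.Sigma.ι (fun _ : classGroup M L₀ => Sc.Mc.obj K) p).left.base :=
  ⟨((Sc.pts K).symm (ShimuraSet.mk L H τ T hT K.1.1 x a)).pt, (AlgPoints.pt_map _ _).symm⟩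

/-! ### §2. The torus translations and the transition maps on summand points -/

/-- **The Hecke translation by `c ∈ T₀(M)(ℚ)\T₀(M)(𝔸_f)/L₀` on points: `c · ([x, aK], p) = ([x, aK], c·p)`** (`translMorExt` is
`Sigma.desc (p ↦ Sigma.ι (c·p))`, read on points by `Sigma.ι_desc`). [cite: Milne2005ShimuraVarieties, (33) p. 58; p. 62 L34–40]
[cite: Liu2021, App. C (C.6) p. 114] -/
theorem map_translMorExt_summandPointExt (Sc : ComplexRecordSystem L H τ T hT K₀)
    (L₀ : C5.OpenCompactSubgroup ↥(torusFinAdelic M)) (K : C5.SmallLevel K₀) (c p : classGroup M L₀) (x : Ball)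
    (a : finAdelic (↥(maximalRealSubfield L)) L (IsCMField.complexConj L) 3 H) :
    AlgPoints.map (translMorExt M Sc L₀ K c) (summandPointExt M Sc L₀ K p x a) = summandPointExt M Sc L₀ K (c * p) x a := by
  rw [summandPointExt, summandPointExt]
  simp only [AlgPoints.map_apply, Category.assoc]
  congr 1
  exact ι_comp_translMorExt M Sc L₀ K c p

/-- Iterated translations: `c' · (c · ([x, aK], p)) = ([x, aK], (c'·c)·p)`. [cite: Milne2005ShimuraVarieties, (33) p. 58] -/
theorem map_translMorExt_map_translMorExt_summandPointExt (Sc : ComplexRecordSystem L H τ T hT K₀)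
    (L₀ : C5.OpenCompactSubgroup ↥(torusFinAdelic M)) (K : C5.SmallLevel K₀) (c c' p : classGroup M L₀) (x : Ball)
    (a : finAdelic (↥(maximalRealSubfield L)) L (IsCMField.complexConj L) 3 H) :
    AlgPoints.map (translMorExt M Sc L₀ K c') (AlgPoints.map (translMorExt M Sc L₀ K c) (summandPointExt M Sc L₀ K p x a)) =
      summandPointExt M Sc L₀ K (c' * c * p) x a := by
  rw [map_translMorExt_summandPointExt, map_translMorExt_summandPointExt, mul_assoc]

/-- **The transition map `Sh_{K×L₀} → Sh_{K'×L₀}` (`K ≤ K'`) on points: `([x, aK], p) ↦ ([x, aK'], p)`** (`complexSystemExt.map f` is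
`Sigma.map (Sc.Mc.map f)`, read on points by `Sigma.ι_map` and `Sc.map_pts`). [cite: Milne2005ShimuraVarieties, Lemma 5.13 p. 57; (33) p. 58]
[cite: Deligne1979ShimuraVarieties, 2.1.4 (PDF p. 24 of Milne's translation)] -/
theorem map_complexSystemExt_map_summandPointExt (Sc : ComplexRecordSystem L H τ T hT K₀)
    (L₀ : C5.OpenCompactSubgroup ↥(torusFinAdelic M)) {K K' : C5.SmallLevel K₀} (f : K ⟶ K') (p : classGroup M L₀) (x : Ball)
    (a : finAdelic (↥(maximalRealSubfield L)) L (IsCMField.complexConj L) 3 H) :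
    AlgPoints.map ((complexSystemExt M Sc L₀).map f) (summandPointExt M Sc L₀ K p x a) = summandPointExt M Sc L₀ K' p x a := by
  have hpts : AlgPoints.map (Sc.Mc.map f) ((Sc.pts K).symm (ShimuraSet.mk L H τ T hT K.1.1 x a)) =
      (Sc.pts K').symm (ShimuraSet.mk L H τ T hT K'.1.1 x a) := by
    rw [← (Sc.pts K').symm_apply_apply (AlgPoints.map (Sc.Mc.map f) _), Sc.map_pts]
  rw [summandPointExt, summandPointExt, ← hpts]
  simp only [AlgPoints.map_apply, Category.assoc]
  congr 1
  exact ι_comp_complexSystemExt_map M Sc L₀ f p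

/-- **Translations commute with transition maps on points**: `f (c · ([x, aK], p)) = c · f ([x, aK], p) = ([x, aK'], c·p)`.
[cite: Milne2005ShimuraVarieties, (33) p. 58] -/
theorem map_complexSystemExt_map_translMorExt_summandPointExt (Sc : ComplexRecordSystem L H τ T hT K₀)
    (L₀ : C5.OpenCompactSubgroup ↥(torusFinAdelic M)) {K K' : C5.SmallLevel K₀} (f : K ⟶ K') (c p : classGroup M L₀) (x : Ball)
    (a : finAdelic (↥(maximalRealSubfield L)) L (IsCMField.complexConj L) 3 H) :
    AlgPoints.map ((complexSystemExt M Sc L₀).map f) (AlgPoints.map (translMorExt M Sc L₀ K c) (summandPointExt M Sc L₀ K p x a)) =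
      AlgPoints.map (translMorExt M Sc L₀ K' c) (AlgPoints.map ((complexSystemExt M Sc L₀).map f) (summandPointExt M Sc L₀ K p x a)) := by
  rw [map_translMorExt_summandPointExt, map_complexSystemExt_map_summandPointExt, map_complexSystemExt_map_summandPointExt,
    map_translMorExt_summandPointExt]

/-- **Two maps out of the complex points of `Sh_{K×L₀}(G̃_M, X̃_M)_ℂ` that agree on all summand points `([x, aK], p)` are equal**
(every point is a summand point). [cite: Milne2005ShimuraVarieties, Lemma 5.13 p. 57; p. 62 L34–40] -/
theorem funext_of_forall_summandPointExt (Sc : ComplexRecordSystem L H τ T hT K₀) (L₀ : C5.OpenCompactSubgroup ↥(torusFinAdelic M))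
    (K : C5.SmallLevel K₀) {β : Sort*} {g g' : ComplexPoints ((complexSystemExt M Sc L₀).obj K) → β}
    (h : ∀ (p : classGroup M L₀) (x : Ball) (a : finAdelic (↥(maximalRealSubfield L)) L (IsCMField.complexConj L) 3 H),
      g (summandPointExt M Sc L₀ K p x a) = g' (summandPointExt M Sc L₀ K p x a)) :
    g = g' := by
  funext P
  obtain ⟨p, x, a, rfl⟩ := exists_summandPointExt_eq M Sc L₀ K P
  exact h p x a

/-! ### §3. The torus translations as morphisms: a `classGroup M L₀`-action commuting with the transition maps -/

/-- **Translations commute with the transition maps** (as morphisms `Sh_{K×L₀} → Sh_{K'×L₀}`): checked on each summand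
(`Sigma.hom_ext`), where both composites are `Sc.Mc.map f ≫ Sigma.ι (c·p)`. [cite: Milne2005ShimuraVarieties, (33) p. 58; Thm. 5.16 p. 59]
[cite: Deligne1979ShimuraVarieties, 2.1.4 (PDF p. 24 of Milne's translation)] -/
theorem translMorExt_comp_map (Sc : ComplexRecordSystem L H τ T hT K₀) (L₀ : C5.OpenCompactSubgroup ↥(torusFinAdelic M))
    {K K' : C5.SmallLevel K₀} (f : K ⟶ K') (c : classGroup M L₀) :
    translMorExt M Sc L₀ K c ≫ (complexSystemExt M Sc L₀).map f =
      (complexSystemExt M Sc L₀).map f ≫ translMorExt M Sc L₀ K' c := by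
  -- work in the `∐`/`Sigma` spelling throughout (the `(complexSystemExt …).obj K` vs `∐` seam defeats `rw` otherwise)
  dsimp only [complexSystemExt, translMorExt]
  refine Limits.Sigma.hom_ext _ _ fun p => ?_
  simp only [Limits.Sigma.ι_desc_assoc, Limits.Sigma.ι_desc, Limits.Sigma.ι_map, Limits.Sigma.ι_map_assoc]

/-- **The translation by `1` is the identity.** [cite: Milne2005ShimuraVarieties, (33) p. 58] -/
theorem translMorExt_one (Sc : ComplexRecordSystem L H τ T hT K₀) (L₀ : C5.OpenCompactSubgroup ↥(torusFinAdelic M))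
    (K : C5.SmallLevel K₀) :
    translMorExt M Sc L₀ K 1 = 𝟙 _ := by
  dsimp only [complexSystemExt, translMorExt]
  refine Limits.Sigma.hom_ext _ _ fun p => ?_
  simp only [Limits.Sigma.ι_desc, Category.comp_id]
  -- `rw [one_mul]` finds no instance under the dependent `Sigma.ι _ (1 * p)`; `congr` does
  congr 1
  exact one_mul p

/-- **Translations compose: `translMorExt (c·c') = translMorExt c' ≫ translMorExt c`** (a left action of the abelian class group
`T₀(M)(ℚ)\T₀(M)(𝔸_f)/L₀` on `Sh_{K×L₀}(G̃_M, X̃_M)_ℂ`). [cite: Milne2005ShimuraVarieties, (33) p. 58; Thm. 5.16 p. 59] -/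
theorem translMorExt_mul (Sc : ComplexRecordSystem L H τ T hT K₀) (L₀ : C5.OpenCompactSubgroup ↥(torusFinAdelic M))
    (K : C5.SmallLevel K₀) (c c' : classGroup M L₀) :
    translMorExt M Sc L₀ K (c * c') = translMorExt M Sc L₀ K c' ≫ translMorExt M Sc L₀ K c := by
  dsimp only [complexSystemExt, translMorExt]
  refine Limits.Sigma.hom_ext _ _ fun p => ?_
  simp only [Limits.Sigma.ι_desc_assoc, Limits.Sigma.ι_desc, mul_assoc]

/-- The translations are isomorphisms (inverse: translation by `c⁻¹`). [cite: Milne2005ShimuraVarieties, (33) p. 58] -/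
theorem translMorExt_inv_comp (Sc : ComplexRecordSystem L H τ T hT K₀) (L₀ : C5.OpenCompactSubgroup ↥(torusFinAdelic M))
    (K : C5.SmallLevel K₀) (c : classGroup M L₀) :
    translMorExt M Sc L₀ K c⁻¹ ≫ translMorExt M Sc L₀ K c = 𝟙 _ := by
  rw [← translMorExt_mul, mul_inv_cancel, translMorExt_one]

/-- The translations are isomorphisms (inverse: translation by `c⁻¹`). [cite: Milne2005ShimuraVarieties, (33) p. 58] -/
theorem translMorExt_comp_inv (Sc : ComplexRecordSystem L H τ T hT K₀) (L₀ : C5.OpenCompactSubgroup ↥(torusFinAdelic M))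
    (K : C5.SmallLevel K₀) (c : classGroup M L₀) :
    translMorExt M Sc L₀ K c ≫ translMorExt M Sc L₀ K c⁻¹ = 𝟙 _ := by
  rw [← translMorExt_mul, inv_mul_cancel, translMorExt_one]

end Aux

end UnitaryCanonicalModel

end Literature.AlgebraicGeometry.ShimuraVarieties

end
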